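import Mathlib
import Summits.AtomisticToContinuum.FouriersLaw.Theses.EmbeddedDrudeMourre
import Summits.AtomisticToContinuum.FouriersLaw.Theorems.EmbeddedDrudeMourreMourreDissolutionSlabFibre
import HarnessLib

/-!
# Geometry of the free pair resonance for stub B1b″ of line `kinetic-polymer-gas-on-the-time-axis`:
# sublevel areas of a function with transversal fibres
(crux `EmbeddedDrudeMourre.DrudeDissolution`, item stmt-AtomisticToContinuum-12593; `--supports` file, closes
nothing; lead c13, abstract form of the geometry input (G-T6b) of the B1b″ discard bound)

WHAT. `area_sublevel_le_of_fibre_transversal` (abstract, Mathlib + the sibling's one-dimensional expanding-map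
tool): let `F : ℝ² → ℝ` be continuous with a continuous fibre derivative `E` (`∂F/∂k₂ = E`) such that EVERY zero of
`F` in the closed cell `[−π,π]²` has `E ≠ 0`. Then there is `C` with
`Area{q ∈ (−π,π]² : |F q| < η} ≤ Cη` for all `η > 0` (the product of the restricted Lebesgue measures). Applied
(next file) to the plane restriction `H₀` of the resonant sheet (`sheetFn_plane_hasDerivAt_snd`,
`sheetFn_plane_deriv_snd_ne_zero`) it gives the area of the tube around the closed co-moving curve, hence the
`O(η²)` volume of the three-dimensional tubes `{Sᵢ² + A² < η²}` discarded by the second-difference estimate.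

HOW. The zero set `Z` in the closed cell is compact; each `z ∈ Z` has an open box on which `E` keeps a sign and
`|E| ≥ c_z > 0`, so every `k₂`-fibre of the box is `c_z`-expanding and meets `{|F| < η}` in length `≤ 2η/c_z`
(`slabFibre_volume_sublevel_le`, Tonelli); finitely many boxes cover `Z` (`IsCompact.elim_finite_subcover`), off
them `|F| ≥ η₀ > 0` on the cell (compactness again), and for `η > η₀` the trivial bound `(2π)² ≤ ((2π)²/η₀)η`
is used.
-/

noncomputable section

open Set Real Topology MeasureTheory
open scoped ENNReal

namespace Summit.AtomisticToContinuum.FouriersLaw.Theorems.DrudeDissolution.KineticPolymerGasOnTheTimeAxis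

/-! ### Local boxes around transversal zeros -/

/-- Around a point where the continuous fibre derivative `E` does not vanish there is an open box on which `E`
keeps its sign with the floor `|E z|/2`. [folklore] -/
theorem exists_box_fibre_floor {E : ℝ × ℝ → ℝ} (hE : Continuous E) {z : ℝ × ℝ} (hz : E z ≠ 0) :
    ∃ r : ℝ, 0 < r ∧ ∀ q : ℝ × ℝ, q.1 ∈ Ioo (z.1 - r) (z.1 + r) → q.2 ∈ Ioo (z.2 - r) (z.2 + r) →
      (0 < E z → |E z| / 2 ≤ E q) ∧ (E z < 0 → E q ≤ -(|E z| / 2)) := by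
  have hpos : 0 < |E z| / 2 := by positivity
  have hc := Metric.continuous_iff.1 hE z (|E z| / 2) hpos
  obtain ⟨δ, hδ, hball⟩ := hc
  refine ⟨δ / 2, by positivity, fun q h1 h2 => ?_⟩
  have hd : dist q z < δ := by
    rw [Prod.dist_eq, Real.dist_eq, Real.dist_eq, max_lt_iff]
    constructor
    · rw [abs_lt]; constructor <;> linarith [h1.1, h1.2]
    · rw [abs_lt]; constructor <;> linarith [h2.1, h2.2]
  have h := hball q hd
  rw [Real.dist_eq, abs_lt] at h
  constructor
  · intro hp
    rw [abs_of_pos hp] at h ⊢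
    linarith [h.1]
  · intro hn
    rw [abs_of_neg hn] at h ⊢
    linarith [h.2]

/-- **One box.** If on the open box `I × J` the fibre derivative satisfies `c ≤ E` (or `E ≤ −c`) with `c > 0`,
then `Area({|F| < η} ∩ (I × J)) ≤ |I|·(2η/c)` for the product Lebesgue measure. [folklore] -/
theorem volume_sublevel_inter_box_le {F E : ℝ × ℝ → ℝ} (hF : Continuous F)
    (hder : ∀ q : ℝ × ℝ, HasDerivAt (fun t : ℝ => F (q.1, t)) (E q) q.2)
    {a b a' b' c : ℝ} (hc : 0 < c)
    (hfloor : (∀ q : ℝ × ℝ, q.1 ∈ Ioo a b → q.2 ∈ Ioo a' b' → c ≤ E q) ∨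
      (∀ q : ℝ × ℝ, q.1 ∈ Ioo a b → q.2 ∈ Ioo a' b' → E q ≤ -c))
    {η : ℝ} :
    (volume.prod volume) ({q : ℝ × ℝ | |F q| < η} ∩ Ioo a b ×ˢ Ioo a' b') ≤
      ENNReal.ofReal (b - a) * ENNReal.ofReal (2 * η / c) := by
  have hA : MeasurableSet {q : ℝ × ℝ | |F q| < η} := measurableSet_lt hF.measurable.abs measurable_const
  have hS : MeasurableSet ({q : ℝ × ℝ | |F q| < η} ∩ Ioo a b ×ˢ Ioo a' b') :=
    hA.inter (measurableSet_Ioo.prod measurableSet_Ioo)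
  rw [Measure.prod_apply hS]
  -- the slices
  have hslice : ∀ x : ℝ, volume (Prod.mk x ⁻¹' ({q : ℝ × ℝ | |F q| < η} ∩ Ioo a b ×ˢ Ioo a' b')) ≤
      (Ioo a b).indicator (fun _ => ENNReal.ofReal (2 * η / c)) x := by
    intro x
    by_cases hx : x ∈ Ioo a b
    · rw [indicator_of_mem hx]
      have hpre : Prod.mk x ⁻¹' ({q : ℝ × ℝ | |F q| < η} ∩ Ioo a b ×ˢ Ioo a' b') =
          Ioo a' b' ∩ (fun t => F (x, t)) ⁻¹' Ioo (0 - η) (0 + η) := by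
        ext t
        simp only [mem_preimage, mem_inter_iff, mem_setOf_eq, mem_prod, zero_sub, zero_add, mem_Ioo, abs_lt]
        constructor
        · rintro ⟨h, -, ht⟩; exact ⟨ht, h⟩
        · rintro ⟨ht, h⟩; exact ⟨h, hx, ht⟩
      rw [hpre]
      -- the fibre is `c`-expanding on `Ioo a' b'`
      have hexp : ∀ s ∈ Ioo a' b', ∀ t ∈ Ioo a' b', c * |t - s| ≤ |F (x, t) - F (x, s)| := by
        rcases hfloor with hf | hf
        · exact MourreDissolution.slabFibre_expand_of_deriv_ge (convex_Ioo a' b')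
            (fun t ht => hder (x, t)) (fun t ht => hf (x, t) hx ht)
        · exact MourreDissolution.slabFibre_expand_of_deriv_le (convex_Ioo a' b')
            (fun t ht => hder (x, t)) (fun t ht => hf (x, t) hx ht)
      exact MourreDissolution.slabFibre_volume_sublevel_le hc hexp 0 η
    · rw [indicator_of_notMem hx]
      have hpre : Prod.mk x ⁻¹' ({q : ℝ × ℝ | |F q| < η} ∩ Ioo a b ×ˢ Ioo a' b') = ∅ := by
        ext t
        simp only [mem_preimage, mem_inter_iff, mem_setOf_eq, mem_prod, mem_empty_iff_false, iff_false, not_and]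
        intro _ h; exact absurd h hx
      rw [hpre, measure_empty]
  calc ∫⁻ x, volume (Prod.mk x ⁻¹' ({q : ℝ × ℝ | |F q| < η} ∩ Ioo a b ×ˢ Ioo a' b'))
      ≤ ∫⁻ x, (Ioo a b).indicator (fun _ => ENNReal.ofReal (2 * η / c)) x := lintegral_mono hslice
    _ = ENNReal.ofReal (2 * η / c) * volume (Ioo a b) := lintegral_indicator_const measurableSet_Ioo _
    _ = ENNReal.ofReal (b - a) * ENNReal.ofReal (2 * η / c) := by rw [Real.volume_Ioo, mul_comm]

/-! ### The abstract sublevel-area bound -/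

/-- **Registered sub-goal `area_sublevel_le_of_fibre_transversal`: sublevel areas of a function whose zeros are
transversal to the `k₂`-fibres.** Let `F : ℝ × ℝ → ℝ` be continuous with a continuous fibre derivative `E`,
`∂F(q.1,·)/∂t = E q` at `q.2`, and suppose `F q = 0 ⇒ E q ≠ 0` on the closed cell `[−π,π]²`. Then there is `C` with
`((vol|(−π,π]).prod (vol|(−π,π])) {q : |F q| < η} ≤ Cη` for every `η > 0`. [folklore] -/
theorem area_sublevel_le_of_fibre_transversal :
    ∀ (F E : ℝ × ℝ → ℝ), Continuous F → Continuous E →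
      (∀ q : ℝ × ℝ, HasDerivAt (fun t : ℝ => F (q.1, t)) (E q) q.2) →
      (∀ q : ℝ × ℝ, q ∈ Icc (-Real.pi) Real.pi ×ˢ Icc (-Real.pi) Real.pi → F q = 0 → E q ≠ 0) →
      ∃ C : ℝ, ∀ η : ℝ, 0 < η →
        ((volume.restrict (Ioc (-Real.pi) Real.pi)).prod (volume.restrict (Ioc (-Real.pi) Real.pi)))
          {q : ℝ × ℝ | |F q| < η} ≤ ENNReal.ofReal (C * η) := by
  intro F E hF hE hder hz
  have hπ := Real.pi_pos
  -- the compact cell and the compact zero set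
  set K : Set (ℝ × ℝ) := Icc (-Real.pi) Real.pi ×ˢ Icc (-Real.pi) Real.pi with hK
  have hKc : IsCompact K := isCompact_Icc.prod isCompact_Icc
  set Z : Set (ℝ × ℝ) := K ∩ F ⁻¹' {0} with hZ
  have hZc : IsCompact Z := hKc.inter_right (isClosed_singleton.preimage hF)
  -- a box with a fibre floor around every zero
  have hbox : ∀ z : Z, ∃ r : ℝ, 0 < r ∧
      ((∀ q : ℝ × ℝ, q.1 ∈ Ioo (z.1.1 - r) (z.1.1 + r) → q.2 ∈ Ioo (z.1.2 - r) (z.1.2 + r) → |E z.1| / 2 ≤ E q) ∨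
       (∀ q : ℝ × ℝ, q.1 ∈ Ioo (z.1.1 - r) (z.1.1 + r) → q.2 ∈ Ioo (z.1.2 - r) (z.1.2 + r) → E q ≤ -(|E z.1| / 2))) := by
    intro z
    have hz0 : E z.1 ≠ 0 := hz z.1 z.2.1 z.2.2
    obtain ⟨r, hr, h⟩ := exists_box_fibre_floor hE hz0
    refine ⟨r, hr, ?_⟩
    rcases lt_or_gt_of_ne hz0 with hn | hp
    · right; exact fun q h1 h2 => (h q h1 h2).2 hn
    · left; exact fun q h1 h2 => (h q h1 h2).1 hp
  choose r hr hfl using hbox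
  set U : Z → Set (ℝ × ℝ) := fun z => Ioo (z.1.1 - r z) (z.1.1 + r z) ×ˢ Ioo (z.1.2 - r z) (z.1.2 + r z) with hU
  have hUo : ∀ z, IsOpen (U z) := fun z => isOpen_Ioo.prod isOpen_Ioo
  have hZU : Z ⊆ ⋃ z, U z := by
    intro q hq
    refine mem_iUnion.2 ⟨⟨q, hq⟩, ?_⟩
    simp only [hU, mem_prod, mem_Ioo]
    have := hr ⟨q, hq⟩
    exact ⟨⟨by linarith, by linarith⟩, ⟨by linarith, by linarith⟩⟩
  obtain ⟨t, ht⟩ := hZc.elim_finite_subcover U hUo hZU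
  -- off the boxes `|F|` has a positive floor on the cell
  set V : Set (ℝ × ℝ) := ⋃ z ∈ t, U z with hV
  have hVo : IsOpen V := isOpen_biUnion fun z _ => hUo z
  have hKV : IsCompact (K \ V) := hKc.diff hVo
  obtain ⟨η₀, hη₀, hfloor⟩ : ∃ η₀ : ℝ, 0 < η₀ ∧ ∀ q ∈ K \ V, η₀ ≤ |F q| := by
    by_cases hem : (K \ V).Nonempty
    · obtain ⟨q₀, hq₀, hmin⟩ := hKV.exists_isMinOn hem hF.abs.continuousOn
      refine ⟨|F q₀|, ?_, fun q hq => hmin hq⟩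
      rw [abs_pos]
      intro h0
      exact hq₀.2 (ht ⟨hq₀.1, h0⟩)
    · exact ⟨1, one_pos, fun q hq => absurd ⟨q, hq⟩ hem⟩
  -- the constant
  set C₁ : ℝ := ∑ z ∈ t, 2 * r z * (2 / (|E z.1| / 2)) with hC₁
  have hC₁0 : 0 ≤ C₁ := by
    rw [hC₁]; exact Finset.sum_nonneg fun z _ => by have := hr z; positivity
  refine ⟨max C₁ ((2 * Real.pi) ^ 2 / η₀), fun η hη => ?_⟩
  set μ₂ : Measure (ℝ × ℝ) := (volume.restrict (Ioc (-Real.pi) Real.pi)).prod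
    (volume.restrict (Ioc (-Real.pi) Real.pi)) with hμ₂
  have hμ₂eq : μ₂ = (volume.prod volume).restrict (Ioc (-Real.pi) Real.pi ×ˢ Ioc (-Real.pi) Real.pi) := by
    rw [hμ₂, Measure.prod_restrict]
  have hA : MeasurableSet {q : ℝ × ℝ | |F q| < η} := measurableSet_lt hF.measurable.abs measurable_const
  by_cases hsmall : η ≤ η₀
  · -- small `η`: the sublevel set inside the cell lies in the boxes
    have hcov : {q : ℝ × ℝ | |F q| < η} ∩ Ioc (-Real.pi) Real.pi ×ˢ Ioc (-Real.pi) Real.pi ⊆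
        ⋃ z ∈ t, ({q : ℝ × ℝ | |F q| < η} ∩ U z) := by
      intro q hq
      have hqK : q ∈ K := ⟨Ioc_subset_Icc_self hq.2.1, Ioc_subset_Icc_self hq.2.2⟩
      have hqV : q ∈ V := by
        by_contra hqV
        have := hfloor q ⟨hqK, hqV⟩
        have h2 : |F q| < η := hq.1
        linarith
      rw [hV] at hqV
      obtain ⟨z, hz1, hz2⟩ := mem_iUnion₂.1 hqV
      exact mem_iUnion₂.2 ⟨z, hz1, hq.1, hz2⟩
    calc μ₂ {q : ℝ × ℝ | |F q| < η}
        = (volume.prod volume) ({q : ℝ × ℝ | |F q| < η} ∩ Ioc (-Real.pi) Real.pi ×ˢ Ioc (-Real.pi) Real.pi) := by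
          rw [hμ₂eq, Measure.restrict_apply hA]
      _ ≤ (volume.prod volume) (⋃ z ∈ t, ({q : ℝ × ℝ | |F q| < η} ∩ U z)) := measure_mono hcov
      _ ≤ ∑ z ∈ t, (volume.prod volume) ({q : ℝ × ℝ | |F q| < η} ∩ U z) := measure_biUnion_finset_le _ _
      _ ≤ ∑ z ∈ t, ENNReal.ofReal (2 * r z) * ENNReal.ofReal (2 * η / (|E z.1| / 2)) := by
          refine Finset.sum_le_sum fun z _ => ?_
          have hcz : 0 < |E z.1| / 2 := by
            have := hz z.1 z.2.1 z.2.2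
            positivity
          have h := volume_sublevel_inter_box_le hF hder hcz (hfl z) (η := η)
            (a := z.1.1 - r z) (b := z.1.1 + r z) (a' := z.1.2 - r z) (b' := z.1.2 + r z)
          rw [show z.1.1 + r z - (z.1.1 - r z) = 2 * r z by ring] at h
          exact h
      _ = ENNReal.ofReal (C₁ * η) := by
          rw [hC₁, Finset.sum_mul, ENNReal.ofReal_sum_of_nonneg]
          · refine Finset.sum_congr rfl fun z _ => ?_
            rw [← ENNReal.ofReal_mul (by have := hr z; positivity)]
            congr 1
            have : |E z.1| / 2 ≠ 0 := by have := hz z.1 z.2.1 z.2.2; positivity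
            field_simp
          · intro z _
            have := hr z
            positivity
      _ ≤ ENNReal.ofReal (max C₁ ((2 * Real.pi) ^ 2 / η₀) * η) := by
          apply ENNReal.ofReal_le_ofReal
          exact mul_le_mul_of_nonneg_right (le_max_left _ _) hη.le
  · -- large `η`: the trivial bound
    rw [not_le] at hsmall
    calc μ₂ {q : ℝ × ℝ | |F q| < η} ≤ μ₂ univ := measure_mono (subset_univ _)
      _ = ENNReal.ofReal ((2 * Real.pi) ^ 2) := by
          rw [hμ₂, Measure.prod_apply MeasurableSet.univ]
          simp only [preimage_univ, Measure.restrict_apply_univ, Real.volume_Ioc, lintegral_const,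
            Measure.restrict_apply_univ]
          rw [show Real.pi - -Real.pi = 2 * Real.pi by ring, ← ENNReal.ofReal_mul (by positivity)]
          congr 1; ring
      _ ≤ ENNReal.ofReal (max C₁ ((2 * Real.pi) ^ 2 / η₀) * η) := by
          apply ENNReal.ofReal_le_ofReal
          calc (2 * Real.pi) ^ 2 = (2 * Real.pi) ^ 2 / η₀ * η₀ := by field_simp
            _ ≤ (2 * Real.pi) ^ 2 / η₀ * η := mul_le_mul_of_nonneg_left hsmall.le (by positivity)
            _ ≤ max C₁ ((2 * Real.pi) ^ 2 / η₀) * η := mul_le_mul_of_nonneg_right (le_max_right _ _) hη.le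

end Summit.AtomisticToContinuum.FouriersLaw.Theorems.DrudeDissolution.KineticPolymerGasOnTheTimeAxis

end
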